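import Summits.CriticalPhenomena.CardyFormulaZ2.Theorems.CardyFlipRussoVoronoiHubFromSmirnovTransportCoupling
import Summits.CriticalPhenomena.CardyFormulaZ2.Theorems.CardyFlipRussoVoronoiHubFromSmirnovMeasurableGraphCross
import Mathlib.MeasureTheory.Constructions.Polish.Basic

/-!
# Stub S3b-iii `stub_graphLaw` of line `moebius-exact-delaunay-dilation-ward`
# (crux `VoronoiHubFromSmirnov`, stmt-CriticalPhenomena-6433, route `CardyFlipRusso`) — lead c3

**The exact law identity for graph crossing events** (`Sig.stub_graphLaw`, GraphDefs module): at
every mesh `δ > 0`, the probability under the inhomogeneous model `ρ = ‖h′‖²` of the pulled-back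
graph crossing event `hGraphCross K A₀ A₂ h V δ` equals the probability, under the homogeneous law
read on the nuclei of the window `h(V)/δ`, of the Euclidean graph crossing event with the image
data `h '' K`, `h '' A₀`, `h '' A₂`.  Same mechanism as the landed S3a (`TransportCoupling.lean`):
* EVENT (`hGraphCross_eq_preimage`): the pulled-back event is the preimage of the image event under
  transport of both colours by `T = PointConfig.imageRestrict (transportMap h δ) (V/δ)` — chains of
  nuclei go to chains of image nuclei and back (injectivity of `h` on `U` lifts the constraints
  `δ qᵢ ∈ h '' K` to `δ pᵢ ∈ K`), adjacency is literally the same;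
* LAW (`map_transport_poissonLaw`, landed): `T_* Poisson(ρ(δ·)Leb) = (restrict (h(V)/δ))_* Poisson(Leb)`;
* MEASURABILITY of the image event: `measurableSet_graphCross` (p157490) with Lusin–Souslin
  measurability of the injective continuous images `h '' K`, `h '' A₀`, `h '' A₂`
  (`MeasurableSet.image_of_continuousOn_injOn`).

References: J. F. C. Kingman, *Poisson Processes* (1993), §2.2–2.3; I. Benjamini, O. Schramm,
Comm. Math. Phys. 197 (1998), §3.  No new definitions.
-/

noncomputable section

namespace Summit.CriticalPhenomena.CardyFormulaZ2.Cruxes.VoronoiHubFromSmirnov.MoebiusExactDelaunayDilationWard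

open scoped Topology ENNReal
open Filter Set MeasureTheory Metric
open Literature.Analysis.FunctionSpaces
open Literature.Probability.RandomPlanarGeometry
open Literature.Probability.LatticeModels (IsDelaunayPair)

/-! ### Step 1: the pulled-back graph event is a preimage of the image graph event -/

/-- **Event identity for graph crossings.** With `h` injective on `U ⊇ V ⊇ K ⊇ A₀, A₂` and the
window `V/δ` relatively compact, `hGraphCross K A₀ A₂ h V δ` is the preimage of
`graphCross (h '' K) (h '' A₀) (h '' A₂) δ` under transport of both colours. -/
theorem hGraphCross_eq_preimage {h : ℂ → ℂ} {U V K A₀ A₂ Kc : Set ℂ} {δ : ℝ}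
    (hi : InjOn h U) (hVU : V ⊆ U) (hKV : K ⊆ V) (hA₀ : A₀ ⊆ K) (hA₂ : A₂ ⊆ K)
    (hδ : 0 < δ) (hKc : IsCompact Kc) (hVK : {b : ℂ | (δ : ℂ) * b ∈ V} ⊆ Kc) :
    hGraphCross K A₀ A₂ h V δ =
      (fun c : PointConfig ℂ × PointConfig ℂ =>
        (PointConfig.imageRestrict (transportMap h δ) {b | (δ : ℂ) * b ∈ V} c.1,
          PointConfig.imageRestrict (transportMap h δ) {b | (δ : ℂ) * b ∈ V} c.2)) ⁻¹'
        graphCross (h '' K) (h '' A₀) (h '' A₂) δ := by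
  have hδ' : (δ : ℂ) ≠ 0 := Complex.ofReal_ne_zero.2 hδ.ne'
  -- physical position of an image nucleus
  have hphys : ∀ p : ℂ, (δ : ℂ) * transportMap h δ p = h ((δ : ℂ) * p) := fun p => by
    unfold transportMap
    rw [mul_div_cancel₀ _ hδ']
  ext c
  simp only [hGraphCross, graphCross, mem_setOf_eq, mem_preimage]
  have hcoe : ∀ d : PointConfig ℂ, ((PointConfig.imageRestrict (transportMap h δ)
      {b | (δ : ℂ) * b ∈ V} d : PointConfig ℂ) : Set ℂ) = transportSet h V δ d := fun d => by
    rw [PointConfig.coe_imageRestrict hKc hVK]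
    rfl
  constructor
  · rintro ⟨N, p, hp1, hpK, hp0, hpN, hadj⟩
    refine ⟨N, fun i => transportMap h δ (p i), fun i => ?_, fun i => ?_, ?_, ?_, fun i => ?_⟩
    · rw [← SetLike.mem_coe, hcoe]
      exact ⟨p i, ⟨hp1 i, hKV (hpK i)⟩, rfl⟩
    · rw [hphys]; exact ⟨_, hpK i, rfl⟩
    · rw [hphys]; exact ⟨_, hp0, rfl⟩
    · rw [hphys]; exact ⟨_, hpN, rfl⟩
    · rw [hcoe, hcoe]; exact hadj i
  · rintro ⟨N, q, hq1, hqK, hq0, hqN, hadj⟩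
    -- lift each image nucleus to a nucleus of `c.1` in the window
    have hlift : ∀ i, ∃ p, p ∈ c.1 ∧ (δ : ℂ) * p ∈ V ∧ transportMap h δ p = q i := by
      intro i
      have := hq1 i
      rw [← SetLike.mem_coe, hcoe] at this
      obtain ⟨p, ⟨hp, hpV⟩, hpq⟩ := this
      exact ⟨p, hp, hpV, hpq⟩
    choose p hp1 hpV hpq using hlift
    -- injectivity of `h` on `U` lifts the physical constraints
    have hliftK : ∀ {i} {B : Set ℂ}, B ⊆ K → (δ : ℂ) * q i ∈ h '' B → (δ : ℂ) * p i ∈ B := by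
      intro i B hB hmem
      obtain ⟨k, hk, hkq⟩ := hmem
      rw [← hpq i, hphys] at hkq
      have := hi (hVU (hKV (hB hk))) (hVU (hpV i)) hkq
      rw [← this]; exact hk
    refine ⟨N, p, hp1, fun i => hliftK Subset.rfl (hqK i), hliftK hA₀ hq0, hliftK hA₂ hqN,
      fun i => ?_⟩
    have := hadj i
    rw [hcoe, hcoe, ← hpq, ← hpq] at this
    exact this

/-- The pulled-back graph event only depends on `h` restricted to `V` (when `K ⊆ V`). -/
theorem hGraphCross_congr {h h' : ℂ → ℂ} {V K A₀ A₂ : Set ℂ} (heqV : EqOn h h' V) (hKV : K ⊆ V)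
    (δ : ℝ) : hGraphCross K A₀ A₂ h V δ = hGraphCross K A₀ A₂ h' V δ := by
  have hts : ∀ c : PointConfig ℂ, transportSet h V δ c = transportSet h' V δ c := by
    intro c
    refine Set.image_congr fun b hb => ?_
    simp only [transportMap, heqV hb.2]
  have htm : ∀ p : ℂ, (δ : ℂ) * p ∈ K → transportMap h δ p = transportMap h' δ p := by
    intro p hp
    simp only [transportMap, heqV (hKV hp)]
  ext c
  simp only [hGraphCross, mem_setOf_eq, hts]
  constructor
  · rintro ⟨N, p, h1, h2, h3, h4, h5⟩
    refine ⟨N, p, h1, h2, h3, h4, fun i => ?_⟩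
    rw [← htm _ (h2 _), ← htm _ (h2 _)]; exact h5 i
  · rintro ⟨N, p, h1, h2, h3, h4, h5⟩
    refine ⟨N, p, h1, h2, h3, h4, fun i => ?_⟩
    rw [htm _ (h2 _), htm _ (h2 _)]; exact h5 i

/-! ### Step 2: the law identity (S3a's `map_transport_poissonLaw`) and assembly -/

/-- **S3b-iii for measurable `h`.** -/
theorem graphLaw_core {h : ℂ → ℂ} {U : Set ℂ}
    (hd : DifferentiableOn ℂ h U) (hi : InjOn h U) (hh : Measurable h) {V : Set ℂ}
    (hV : IsOpen V) (hVb : Bornology.IsBounded V) (hVU : closure V ⊆ U) {ρ : ℂ → ℝ}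
    (hρ : AdmissibleDensity ρ) (hρV : ∀ z ∈ V, ρ z = ‖deriv h z‖ ^ 2) {K A₀ A₂ : Set ℂ} {δ : ℝ}
    (hδ : 0 < δ) (hKm : MeasurableSet K) (hA₀m : MeasurableSet A₀) (hA₂m : MeasurableSet A₂)
    (hKV : K ⊆ V) (hA₀ : A₀ ⊆ K) (hA₂ : A₂ ⊆ K) :
    (lawBW (intensity ρ 1 δ)).real (hGraphCross K A₀ A₂ h V δ) =
      (lawBW (volume : Measure ℂ)).real
        {c | (PointConfig.restrict {b : ℂ | (δ : ℂ) * b ∈ h '' V} c.1,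
          PointConfig.restrict {b : ℂ | (δ : ℂ) * b ∈ h '' V} c.2) ∈
          graphCross (h '' K) (h '' A₀) (h '' A₂) δ} := by
  have hVU' : V ⊆ U := subset_closure.trans hVU
  have hopen : IsOpen (h '' V) :=
    isOpen_image_of_injOn_closure hV (hd.continuousOn.mono hVU) (hi.mono hVU)
  obtain ⟨Kc, hKc, hVK⟩ := exists_isCompact_window hVb hδ
  set T : PointConfig ℂ → PointConfig ℂ :=
    PointConfig.imageRestrict (transportMap h δ) {b | (δ : ℂ) * b ∈ V} with hT
  set Rs : PointConfig ℂ → PointConfig ℂ := PointConfig.restrict {b : ℂ | (δ : ℂ) * b ∈ h '' V}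
    with hRs
  have hTm : Measurable T := PointConfig.measurable_imageRestrict hKc hVK
    (isOpen_window hV δ).measurableSet (measurable_transportMap hh δ)
    (injOn_transportMap (hi.mono hVU') hδ.ne')
  have hRsm : Measurable Rs := PointConfig.measurable_restrict (isOpen_window hopen δ).measurableSet
  have hlaw : (poissonLaw (intensity ρ 1 δ)).map T = (poissonLaw volume).map Rs :=
    map_transport_poissonLaw hd hi hh hV hVb hVU hρ hρV hδ
  -- measurability of the image event: Lusin–Souslin for the images, then the brick
  have hcont : ContinuousOn h V := hd.continuousOn.mono hVU'
  have himK : MeasurableSet (h '' K) := hKm.image_of_continuousOn_injOn (hcont.mono hKV)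
    (hi.mono (hKV.trans hVU'))
  have himA₀ : MeasurableSet (h '' A₀) := hA₀m.image_of_continuousOn_injOn
    (hcont.mono (hA₀.trans hKV)) (hi.mono ((hA₀.trans hKV).trans hVU'))
  have himA₂ : MeasurableSet (h '' A₂) := hA₂m.image_of_continuousOn_injOn
    (hcont.mono (hA₂.trans hKV)) (hi.mono ((hA₂.trans hKV).trans hVU'))
  have hE : MeasurableSet (graphCross (h '' K) (h '' A₀) (h '' A₂) δ) :=
    measurableSet_graphCross _ _ _ δ himK himA₀ himA₂ hδ
  have hprod : (lawBW (intensity ρ 1 δ)).map (Prod.map T T) =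
      (lawBW (volume : Measure ℂ)).map (Prod.map Rs Rs) := by
    haveI := isProbabilityMeasure_poissonLaw_intensity ρ hρ.continuous 1 δ
    haveI := isPoissonPointProcess_poissonLaw_volume.isProbabilityMeasure
    unfold lawBW
    rw [← Measure.map_prod_map _ _ hTm hTm, ← Measure.map_prod_map _ _ hRsm hRsm, hlaw]
  rw [hGraphCross_eq_preimage hi hVU' hKV hA₀ hA₂ hδ hKc hVK]
  have e1 : (lawBW (intensity ρ 1 δ)).real ((fun c : PointConfig ℂ × PointConfig ℂ =>
      (T c.1, T c.2)) ⁻¹' graphCross (h '' K) (h '' A₀) (h '' A₂) δ) =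
      ((lawBW (intensity ρ 1 δ)).map (Prod.map T T)).real
        (graphCross (h '' K) (h '' A₀) (h '' A₂) δ) := by
    rw [measureReal_def, measureReal_def, Measure.map_apply (hTm.prodMap hTm) hE]
    rfl
  have e2 : (lawBW (volume : Measure ℂ)).real
      {c | (Rs c.1, Rs c.2) ∈ graphCross (h '' K) (h '' A₀) (h '' A₂) δ} =
      ((lawBW (volume : Measure ℂ)).map (Prod.map Rs Rs)).real
        (graphCross (h '' K) (h '' A₀) (h '' A₂) δ) := by
    rw [measureReal_def, measureReal_def, Measure.map_apply (hRsm.prodMap hRsm) hE]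
    rfl
  rw [e1, hprod, ← e2]

/-- **S3b-iii, the graph law identity** (registered skeleton stub `stub_graphLaw` of the crux's
re-cut S3b): the probability of the pulled-back graph crossing event under the inhomogeneous model
equals, at every mesh, the probability of the image graph event under the homogeneous law read on
the window `h(V)/δ`. -/
theorem stub_graphLaw : Sig.stub_graphLaw := by
  intro R h U hU hRU hd hi V hV hVb hΩV hVU ρ hρ hρV K A₀ A₂ δ hδ hKm hA₀m hA₂m hKV hA₀ hA₂
  -- measurable modification of `h` off `U`
  set h' : ℂ → ℂ := U.indicator h with hh'
  have heqU : EqOn h h' U := fun x hx => (Set.indicator_of_mem hx h).symm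
  have hh'm : Measurable h' := measurable_indicator_of_continuousOn hU hd.continuousOn
  have hd' : DifferentiableOn ℂ h' U := hd.congr fun x hx => (heqU hx).symm
  have hi' : InjOn h' U := hi.congr heqU
  have hVU' : V ⊆ U := subset_closure.trans hVU
  have hρV' : ∀ z ∈ V, ρ z = ‖deriv h' z‖ ^ 2 := by
    intro z hz
    rw [hρV z hz]
    congr 2
    refine Filter.EventuallyEq.deriv_eq ?_
    filter_upwards [hU.mem_nhds (hVU' hz)] with w hw
    exact heqU hw
  have hcore := graphLaw_core hd' hi' hh'm hV hVb hVU hρ hρV' hδ hKm hA₀m hA₂m hKV hA₀ hA₂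
  have hKU : EqOn h h' K := heqU.mono (hKV.trans hVU')
  rw [hGraphCross_congr (heqU.mono hVU') hKV δ, hcore, ← (heqU.mono hVU').image_eq, ← hKU.image_eq,
    ← (hKU.mono hA₀).image_eq, ← (hKU.mono hA₂).image_eq]

end Summit.CriticalPhenomena.CardyFormulaZ2.Cruxes.VoronoiHubFromSmirnov.MoebiusExactDelaunayDilationWard

end
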